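import Mathlib.Algebra.Order.Antidiag.Finsupp
import Mathlib.LinearAlgebra.Matrix.Permanent
import Mathlib.Data.Fintype.Card
import Literature.Computability.AlgebraicComplexity.OrbitClosure
import Literature.Computability.AlgebraicComplexity.OrbitClosureProofs
import Literature.Computability.AlgebraicComplexity.DeterminantalComplexityProofs
import Literature.Computability.AlgebraicComplexity.StandardFamilies
import Literature.Computability.AlgebraicComplexity.ValiantClasses
import Literature.Computability.AlgebraicComplexity.PencilFamily
import Summits.ValiantsHypothesis.ValiantsHypothesis.Theses.UnpaddedGIT

/-!
# Route `UnpaddedGIT`, support item `PaddedToPencil`: the padded model maps to the pencil model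

Route `ValiantsHypothesis/UnpaddedGIT`, item `stmt-ValiantsHypothesis-5762` (`PaddedToPencil`, model
comparison with route `GCTMult`): for `n ≤ m`, if the padded permanent `X₀₀ ^ (m - n) · per_n` lies in
the orbit closure `Δ[det_m]` (`HasBorderDetRepr ℂ n m`), then the coefficient vector of `per_n` lies in
the Zariski closure of (the coefficient vectors of) the pencil-coefficient family
`D_m(n) = {hc_n (det A) : A an m × m matrix of affine linear forms in the n² variables}`.

Proof. *Linear maps are Zariski continuous on forms of a fixed degree*
(`coeffVec_apply_mem_zariskiClosure_of_isHomogeneous`): for a `k`-linear map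
`Λ : k[x_σ] → k[x_τ]` and a form `f` of degree `M`, `coeff e (Λ f) = ∑_{|d| = M} coeff d f · coeff e (Λ X^d)`
(`coeff_apply_eq_sum_finsuppAntidiag`), so a test polynomial `p` on the coefficient space of `k[x_τ]`
pulls back to the test polynomial `p ∘ Λ` obtained by substituting the linear form
`∑_{|d| = M} coeff e (Λ X^d) • X_d` for `X_e` (`aeval_coeffVec_linearPullback`); hence if `Λ` maps a
set `S` of degree-`M` forms into `T`, it maps degree-`M` forms in the Zariski closure of `S` into the
Zariski closure of `T`. Apply this to `Λ = hc_n ∘ (aeval a)` with `a` the *de-padding projection*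
(block variable `(i, j) ↦ X (e i, e j)` for a bijection `e : BlockIdx n m ≃ Fin n`, every other
variable `↦ 1`, as in `Theorems/BorderApolarityFixedWitnessObstructionQPUnpad.lean`), `S = GL · det_m`,
`T = D_m(n)`: an element `g · det_m` of the orbit is the determinant of an `m × m` matrix of linear
forms, its projection `aeval a (g · det_m)` is the determinant of an `m × m` matrix of affine forms
(`hasDetRepr_linSubst`, `HasDetRepr.of_isProjection_holds`), so `Λ (g · det_m) ∈ D_m(n)`; and
`aeval a (X₀₀ ^ (m - n) per_n) = per_n` (the padding factor goes to `1`, the block permanent is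
renamed to `per_n`, `rename_perPoly_equiv`), so `Λ (X₀₀ ^ (m - n) per_n) = hc_n per_n = per_n`.

Sources: K. Mulmuley, M. Sohoni, *GCT I*, SIAM J. Comput. 31 (2001) §4 (orbit closures in
coefficient space); J. M. Landsberg, *Geometry and complexity theory* (2017) §6.1.6 (pencils
`det (ℓ Λ + ∑ A_ij y_ij)`); P. Bürgisser, C. Ikenmeyer, G. Panova, J. AMS 32 (2019) §1 (padded
permanent).
-/

noncomputable section

open MvPolynomial
open scoped BigOperators Matrix
open Literature.Computability.AlgebraicComplexity

namespace Summit.ValiantsHypothesis.ValiantsHypothesis.Theorems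

namespace UnpaddedGITPaddedToPencil

variable {k : Type*} [Field k] {σ τ : Type*} [Fintype σ] [DecidableEq σ]

/-- **A linear map in the monomial basis, on forms of degree `M`.** For a `k`-linear map
`Λ : k[x_σ] → k[x_τ]`, a form `f` of degree `M` and a monomial `e`,
`coeff e (Λ f) = ∑_{|d| = M} coeff d f · coeff e (Λ X^d)`, the sum over the finite set
`Finset.univ.finsuppAntidiag M` of monomials of degree `M` in the variables `σ` (expand `f` in the
monomial basis; its support consists of monomials of degree `M`). [folklore] -/
theorem coeff_apply_eq_sum_finsuppAntidiag (Λ : MvPolynomial σ k →ₗ[k] MvPolynomial τ k) {M : ℕ}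
    {f : MvPolynomial σ k} (hf : f.IsHomogeneous M) (e : τ →₀ ℕ) :
    coeff e (Λ f) = ∑ d ∈ (Finset.univ : Finset σ).finsuppAntidiag M,
      coeff d f * coeff e (Λ (monomial d 1)) := by
  set G : (σ →₀ ℕ) → k := fun d => coeff d f * coeff e (Λ (monomial d 1)) with hG
  -- expand `f` in the monomial basis
  have hsupp : coeff e (Λ f) = ∑ d ∈ f.support, G d := by
    conv_lhs => rw [f.as_sum, map_sum, coeff_sum]
    refine Finset.sum_congr rfl fun d _ => ?_
    have hsplit : (monomial d (coeff d f) : MvPolynomial σ k) = coeff d f • monomial d 1 := by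
      rw [smul_monomial, smul_eq_mul, mul_one]
    rw [hsplit, map_smul, coeff_smul, smul_eq_mul]
  -- the support of `f` consists of monomials of degree `M`
  have hmem : ∀ d : σ →₀ ℕ,
      d ∈ (Finset.univ : Finset σ).finsuppAntidiag M ↔ d.degree = M := by
    intro d
    simp [Finset.mem_finsuppAntidiag, Finsupp.degree_eq_sum]
  rw [hsupp]
  refine Finset.sum_subset (fun d hd => ?_) (fun d _ hd => ?_)
  · rw [hmem, Finsupp.degree_apply]
    exact (hf.degree_eq_sum_deg_support hd).symm
  · simp [hG, notMem_support_iff.mp hd]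

/-- **Pull-back of test polynomials along a linear map.** For a `k`-linear map `Λ : k[x_σ] → k[x_τ]`
and a degree `M`, substituting the linear form `∑_{|d| = M} coeff e (Λ X^d) • X_d` for the coordinate
`X_e` turns a test polynomial `p` on the coefficient space of `k[x_τ]` into one on the coefficient
space of `k[x_σ]` whose value at (the coefficient vector of) a form `f` of degree `M` is `p (Λ f)`
(Mulmuley–Sohoni 2001 §4: linear maps of `Sym^M` act on coordinate rings by substitution). [folklore] -/
theorem aeval_coeffVec_linearPullback (Λ : MvPolynomial σ k →ₗ[k] MvPolynomial τ k) {M : ℕ}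
    {f : MvPolynomial σ k} (hf : f.IsHomogeneous M) (p : MvPolynomial (τ →₀ ℕ) k) :
    aeval (coeffVec f) (aeval (fun e : τ →₀ ℕ =>
      ∑ d ∈ (Finset.univ : Finset σ).finsuppAntidiag M,
        coeff e (Λ (monomial d 1)) • (X d : MvPolynomial (σ →₀ ℕ) k)) p) =
      aeval (coeffVec (Λ f)) p := by
  have hFG : (fun e : τ →₀ ℕ => aeval (coeffVec f)
      (∑ d ∈ (Finset.univ : Finset σ).finsuppAntidiag M,
        coeff e (Λ (monomial d 1)) • (X d : MvPolynomial (σ →₀ ℕ) k))) = coeffVec (Λ f) := by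
    funext e
    simp only [map_sum, map_smul, aeval_X, coeffVec_apply, smul_eq_mul]
    rw [coeff_apply_eq_sum_finsuppAntidiag Λ hf]
    exact Finset.sum_congr rfl fun d _ => mul_comm _ _
  rw [← AlgHom.comp_apply, comp_aeval, hFG]

/-- **Linear maps are Zariski continuous on forms of a fixed degree.** Let `Λ : k[x_σ] → k[x_τ]` be
`k`-linear, `S` a set of forms of degree `M` in the variables `σ` with `Λ S ⊆ T`. If the
coefficient vector of a form `g` of degree `M` lies in the Zariski closure of `coeffVec '' S`, then
the coefficient vector of `Λ g` lies in the Zariski closure of `coeffVec '' T`: a test polynomial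
vanishing on `T` pulls back (`aeval_coeffVec_linearPullback`) to one vanishing on `S`, hence at `g`.
(Mulmuley–Sohoni 2001 §4; polynomial maps are continuous for the Zariski topology.) [folklore] -/
theorem coeffVec_apply_mem_zariskiClosure_of_isHomogeneous
    (Λ : MvPolynomial σ k →ₗ[k] MvPolynomial τ k) {M : ℕ}
    {S : Set (MvPolynomial σ k)} {T : Set (MvPolynomial τ k)}
    (hS : ∀ f ∈ S, f.IsHomogeneous M) (hST : ∀ f ∈ S, Λ f ∈ T)
    {g : MvPolynomial σ k} (hg : g.IsHomogeneous M)
    (hmem : coeffVec g ∈ zariskiClosure (coeffVec '' S)) :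
    coeffVec (Λ g) ∈ zariskiClosure (coeffVec '' T) := by
  rw [mem_zariskiClosure_iff] at hmem ⊢
  intro p hp
  rw [← aeval_coeffVec_linearPullback Λ hg]
  apply hmem
  rintro _ ⟨f, hf, rfl⟩
  rw [aeval_coeffVec_linearPullback Λ (hS f hf)]
  exact hp _ ⟨Λ f, hST f hf, rfl⟩

end UnpaddedGITPaddedToPencil

open UnpaddedGITPaddedToPencil in
/-- **Item `PaddedToPencil` of route `UnpaddedGIT`** (model comparison with route `GCTMult`): for
`n ≤ m`, if the padded permanent `X₀₀ ^ (m - n) · per_n` lies in the orbit closure of `det_m`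
(`HasBorderDetRepr ℂ n m`), then `per_n` lies in the Zariski closure, in its own coefficient space,
of the pencil-coefficient family `D_m(n)` of degree-`n` components `hc_n (det A)` of determinants of
`m × m` matrices `A` of affine linear forms in the `n²` variables. Proof: the linear map
`Λ = hc_n ∘ (aeval a)`, `a` the de-padding projection (block variable `↦` variable of `per_n`, every
other variable `↦ 1`), is Zariski continuous on forms of degree `m`
(`coeffVec_apply_mem_zariskiClosure_of_isHomogeneous`), maps the orbit `GL · det_m` into `D_m(n)`
(a projection of a determinant of linear forms is a determinant of affine forms,
`HasDetRepr.of_isProjection_holds`) and maps the padded permanent to `hc_n (per_n) = per_n`.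
(Mulmuley–Sohoni 2001 §4; Landsberg 2017 §6.1.6; Bürgisser–Ikenmeyer–Panova 2019 §1.) -/
theorem paddedToPencil_proof :
    Summit.ValiantsHypothesis.ValiantsHypothesis.Theses.UnpaddedGIT.PaddedToPencil := by
  intro n m _ hnm hB
  classical
  -- a bijection between the block indices and `Fin n`
  let e : BlockIdx n m ≃ Fin n := Fintype.equivFinOfCardEq (card_blockIdx hnm)
  -- the de-padding substitution: block variables to the variables of `per_n`, everything else to `1`
  let a : Fin m × Fin m → MvPolynomial (Fin n × Fin n) ℂ := fun p =>
    if h : m - n ≤ (p.1 : ℕ) ∧ m - n ≤ (p.2 : ℕ) then X (e ⟨p.1, h.1⟩, e ⟨p.2, h.2⟩) else C 1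
  have ha : ∀ p, (∃ q, a p = X q) ∨ ∃ c, a p = C c := by
    intro p
    by_cases h : m - n ≤ (p.1 : ℕ) ∧ m - n ≤ (p.2 : ℕ)
    · exact Or.inl ⟨_, dif_pos h⟩
    · exact Or.inr ⟨1, dif_neg h⟩
  -- the padding factor is sent to `1`
  have h00 : a (0, 0) ^ (m - n) = 1 := by
    rcases Nat.eq_zero_or_pos (m - n) with h0 | hpos
    · rw [h0, pow_zero]
    · have h : ¬ (m - n ≤ (((0, 0) : Fin m × Fin m).1 : ℕ) ∧
          m - n ≤ (((0, 0) : Fin m × Fin m).2 : ℕ)) := by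
        simp only [Fin.val_zero, Nat.le_zero, and_self]
        omega
      rw [show a (0, 0) = C 1 from dif_neg h, C_1, one_pow]
  -- on the block the substitution is the renaming along `Prod.map e e`
  have hcomp : (a ∘ fun ij : BlockIdx n m × BlockIdx n m => ((ij.1 : Fin m), (ij.2 : Fin m))) =
      X ∘ Prod.map e e := by
    funext ij
    obtain ⟨i, j⟩ := ij
    simp only [Function.comp_apply, Prod.map_apply, a, dif_pos (And.intro i.2 j.2), Subtype.coe_eta]
  have hper : aeval a (paddedPerPoly ℂ n m) = perPoly (Fin n) ℂ := by
    rw [paddedPerPoly, map_mul, map_pow, aeval_X, h00, one_mul, aeval_rename, hcomp,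
      ← rename_eq_aeval, rename_perPoly_equiv]
  -- homogeneity of the two standard families
  have hperhom : (perPoly (Fin n) ℂ).IsHomogeneous n := by
    simpa using perPoly_isHomogeneous (n := Fin n) (k := ℂ)
  have hdethom : (detPoly (Fin m) ℂ).IsHomogeneous m := by
    simpa using detPoly_isHomogeneous (n := Fin m) (k := ℂ)
  -- the linear map `Λ = hc_n ∘ (aeval a)` on coefficient space
  let Λ : MvPolynomial (Fin m × Fin m) ℂ →ₗ[ℂ] MvPolynomial (Fin n × Fin n) ℂ :=
    (homogeneousComponent n).comp (aeval a).toLinearMap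
  have hΛ : ∀ f, Λ f = homogeneousComponent n (aeval a f) := fun f => rfl
  have hΛper : Λ (paddedPerPoly ℂ n m) = perPoly (Fin n) ℂ := by
    rw [hΛ, hper, homogeneousComponent_eq_self hperhom]
  have hB' : coeffVec (paddedPerPoly ℂ n m) ∈
      zariskiClosure (coeffVec '' glOrbit (Fin m × Fin m) ℂ (detPoly (Fin m) ℂ)) := hB
  rw [← hΛper]
  refine coeffVec_apply_mem_zariskiClosure_of_isHomogeneous Λ ?_ ?_
    (paddedPerPoly_isHomogeneous hnm) hB'
  · -- the orbit consists of forms of degree `m`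
    rintro _ ⟨g, rfl⟩
    dsimp only
    rw [linSubstRep_apply]
    exact linSubst_isHomogeneous _ hdethom
  · -- `Λ (g · det_m) = hc_n det (a ∘ (g · X)) ∈ D_m(n)`
    rintro _ ⟨g, rfl⟩
    dsimp only
    rw [linSubstRep_apply, hΛ]
    obtain ⟨A, hA, hdetA⟩ := HasDetRepr.of_isProjection_holds
      (hasDetRepr_linSubst (g : Matrix (Fin m × Fin m) (Fin m × Fin m) ℂ) (hasDetRepr_detPoly m))
      ⟨a, ha, rfl⟩
    exact ⟨A, hA, by rw [hdetA]⟩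

end Summit.ValiantsHypothesis.ValiantsHypothesis.Theorems
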